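import Summits.Schanuel.Schanuel.Theorems.RootDecomp1ETwoScale03

/-!
# RootDecomp1ETwoScale — lens 2, generation 37 «TWO-SCALE E-PLANES» (items 25020 / 31409 of route 1E at n = 4 on `InTwoScaleClass`, mod NW96 Thm 1) — continuation (RootDecomp1ETwoScale04): §3 `clash_at_scale (hNW)` (`maxHeartbeats 1600000` as in the source) and `const_term_lower_bound` (level `K = 0`, fact-free)

(lens-2 g37 `TwoScale.lean` v2 [HOME/decomp-schanuel-lens-2/g37/TwoScale.lean v2 sha256 e81e28b8…d084, 2853 l (v1 df3b5e32…, 2509 l + §5b); own farm rc 0 · 0 warn · 0 sorry · axioms std; critic VERDICT STATUS L1776 (credit E-R17, PORT GO), v2 ACK L1780]; port by census-1 gen 16 in nine parts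
`RootDecomp1ETwoScale01`–`09` — see the PORT NOTE of part 01; `--supports stmt-Schanuel-31409`; rung 0.)
-/

noncomputable section

open Complex Polynomial IntermediateField Filter

namespace Summit.Schanuel.Schanuel.Theorems.RootDecomp1ETwoScale

open Summit.Schanuel.Schanuel.Theorems.RootDecomp1KHyper
open Summit.Schanuel.Schanuel.Theorems.RootDecomp1KHyper.HyperCell
open Summit.Schanuel.Schanuel.Theorems.RootDecomp1KGeneric
open Literature.NumberTheory.Transcendental (NesterenkoWaldschmidt1996_thm_1 weilHeight₁)

variable {K : ℕ}

/-- `1 ≤ log x` for `x ≥ 3`. -/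
private theorem one_le_log_of_three_le {x : ℝ} (hx : 3 ≤ x) : 1 ≤ Real.log x := by
  rw [Real.le_log_iff_exp_le (by linarith)]
  have := Real.exp_one_lt_d9
  linarith

/-- The linear integer polynomial `q·X − p` of a rational `r = p/q` is irreducible (copy of lens 6's
private `Generic18` lemma). -/
private theorem irreducible_den_mul_X_sub_num' (r : ℚ) :
    Irreducible (C (r.den : ℤ) * X + C (-r.num) : ℤ[X]) := by
  have hden : (r.den : ℤ) ≠ 0 := by exact_mod_cast r.den_ne_zero
  have hdeg : (C (r.den : ℤ) * X + C (-r.num) : ℤ[X]).degree = 1 := by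
    rw [degree_add_eq_left_of_degree_lt] <;> rw [degree_C_mul_X hden]
    exact degree_C_le.trans_lt (by norm_num)
  have hprim : (C (r.den : ℤ) * X + C (-r.num) : ℤ[X]).IsPrimitive := by
    intro c hc
    rw [C_dvd_iff_dvd_coeff] at hc
    have h1 : c ∣ (r.den : ℤ) := by
      have := hc 1
      rwa [coeff_add, coeff_C_mul, coeff_X_one, mul_one, coeff_C, if_neg one_ne_zero,
        add_zero] at this
    have h0 : c ∣ r.num := by
      have := hc 0
      rwa [coeff_add, coeff_C_mul, coeff_X_zero, mul_zero, zero_add, coeff_C_zero, dvd_neg] at this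
    obtain ⟨u, v, huv⟩ := Rat.isCoprime_num_den r
    exact isUnit_of_dvd_one
      (huv ▸ dvd_add (dvd_mul_of_dvd_right h0 u) (dvd_mul_of_dvd_right h1 v))
  rw [hprim.irreducible_iff_irreducible_map_fraction_map (K := ℚ)]
  apply irreducible_of_degree_eq_one
  rwa [degree_map_eq_of_injective (algebraMap ℤ ℚ).injective_int]

/-- `q·X − p` has degree `1`, root `r`, and Mahler measure `max(|p|, q)` (copy of lens 6's private lemma). -/
private theorem linear_poly_facts (r : ℚ) :
    (C (r.den : ℤ) * X + C (-r.num) : ℤ[X]).natDegree = 1 ∧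
      aeval ((r : ℝ) : ℂ) (C (r.den : ℤ) * X + C (-r.num) : ℤ[X]) = 0 ∧
      ((C (r.den : ℤ) * X + C (-r.num) : ℤ[X]).map (Int.castRingHom ℂ)).mahlerMeasure =
        max (|(r.num : ℝ)|) (r.den : ℝ) := by
  have hden : (r.den : ℤ) ≠ 0 := by exact_mod_cast r.den_ne_zero
  refine ⟨by rw [natDegree_add_C, natDegree_C_mul_X _ hden], ?_, ?_⟩
  · rw [Complex.ofReal_ratCast, map_add, map_mul, aeval_X, aeval_C, aeval_C, algebraMap_int_eq,
      eq_intCast, eq_intCast, Int.cast_neg, Int.cast_natCast]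
    have : (r : ℂ) * (r.den : ℂ) = (r.num : ℂ) := by exact_mod_cast Rat.mul_den_eq_num r
    linear_combination this
  · have hmap : (C (r.den : ℤ) * X + C (-r.num) : ℤ[X]).map (Int.castRingHom ℂ) =
        C (r.den : ℂ) * X + C (-(r.num : ℂ)) := by
      simp [Polynomial.map_add, Polynomial.map_mul]
    rw [hmap, mahlerMeasure_C_mul_X_add_C (by exact_mod_cast r.den_ne_zero), norm_neg,
      Complex.norm_natCast, Complex.norm_intCast, max_comm]

/-- The Mahler measure of a non-zero integer polynomial (over `ℂ`) is at least `1`. -/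
private theorem one_le_mahlerMeasure_int {R : ℤ[X]} (hR : R ≠ 0) :
    1 ≤ (R.map (Int.castRingHom ℂ)).mahlerMeasure := by
  refine one_le_mahlerMeasure_of_one_le_norm_leadingCoeff ?_
  rw [Polynomial.leadingCoeff_map_of_injective (RingHom.injective_int _), eq_intCast,
    Complex.norm_intCast]
  exact_mod_cast Int.one_le_abs (Polynomial.leadingCoeff_ne_zero.mpr hR)

set_option maxHeartbeats 1600000 in
/-- **The clash at one scale** (`K ≥ 1`).  If at a reduced fraction `r = p/q` (`q ≥ 3`, `q ≥ Λ + 1, 2^K`,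
`q > 1/|e^ρ|`, `q^D G_K(p/q) ≠ 0`) BOTH `|ρ − r|` and the value `ε = |Σ_k G_k(ρ) e^{kρ}|` are
`≤ exp(−i(H) (log q)²)`, then the root `y` of `A_q` nearest `e^ρ` and `β = r` contradict NW96 Thm 1
(lens 6's budget, verbatim, with `m = κ(H) + 3`). -/
theorem clash_at_scale (hNW : NesterenkoWaldschmidt1996_thm_1) {ρ : ℝ} (hρ0 : ρ ≠ 0) (hK : 0 < K)
    (G : Fin (K + 1) → ℤ[X]) (hGK : G (Fin.last K) ≠ 0) {D : ℕ} (hD : ∀ k, (G k).natDegree ≤ D)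
    {Λ : ℝ} (hΛ0 : 0 ≤ Λ)
    (hΛ : ∀ z : ℂ, ‖z - (ρ : ℂ)‖ ≤ 1 →
      ‖(sliceAt G (cexp ρ)).eval z - (sliceAt G (cexp ρ)).eval (ρ : ℂ)‖ ≤ Λ * ‖z - (ρ : ℂ)‖)
    (r : ℚ) (hq3 : 3 ≤ r.den) (h0 : scaleEval (G (Fin.last K)) D r.num r.den ≠ 0)
    (hΛq : Λ + 1 ≤ r.den) (h2K : (2 : ℝ) ^ K ≤ r.den) (hwq : 1 / ‖cexp (ρ : ℂ)‖ < r.den)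
    (hη : |ρ - r| ≤ Real.exp (-(cIdx ρ K D (relLen G) * Real.log r.den ^ 2)))
    (hε : ‖∑ k : Fin (K + 1), aeval (ρ : ℂ) (G k) * cexp ρ ^ (k : ℕ)‖ ≤
      Real.exp (-(cIdx ρ K D (relLen G) * Real.log r.den ^ 2))) : False := by
  classical
  set w : ℂ := cexp ρ with hw
  have hw0 : 0 < ‖w‖ := norm_pos_iff.mpr (Complex.exp_ne_zero _)
  set H : ℝ := relLen G with hH
  have hH1 : 1 ≤ H := one_le_relLen G hGK
  set A : ℝ := cA ρ with hA
  have hA1 : 1 ≤ A := one_le_cA ρ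
  set c : ℝ := cHt ρ K D H with hc
  have hc0 : 0 ≤ c := cHt_nonneg ρ K D hH1
  set κ : ℝ := cKap ρ K D H with hκ
  have hκ0 : 0 ≤ κ := cKap_nonneg ρ K D H
  set m : ℝ := κ + 3 with hm
  have hm0 : 0 ≤ m := by rw [hm]; linarith
  set i : ℝ := cIdx ρ K D H with hi
  have hiK : i = (K : ℝ) * (m + 1) + D + 2 := by rw [hi, hm, cIdx]; ring
  have hKr : (1 : ℝ) ≤ K := by exact_mod_cast hK
  have hi0 : 0 ≤ i := by rw [hiK]; positivity
  have hq3r : (3 : ℝ) ≤ r.den := by exact_mod_cast hq3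
  have hq0r : (0 : ℝ) < r.den := by linarith
  have hq1r : (1 : ℝ) ≤ r.den := by linarith
  set L : ℝ := Real.log r.den with hL
  have hL1 : 1 ≤ L := one_le_log_of_three_le hq3r
  have hL0 : 0 ≤ L := by linarith
  have hLL : L ≤ L ^ 2 := by nlinarith
  have hexpL : Real.exp L = r.den := by rw [hL, Real.exp_log hq0r]
  have hqw : 1 / (r.den : ℝ) < ‖w‖ := by
    rw [div_lt_iff₀ hq0r]; rw [div_lt_iff₀ hw0] at hwq; linarith
  have hlK0 : 0 ≤ Real.log ((K : ℝ) + 1) := Real.log_nonneg (by linarith)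
  have hlR0 : 0 ≤ Real.log H := Real.log_nonneg hH1
  have hAc : A ≤ c := by
    have : 0 ≤ ((D : ℝ) + 1) * A := by positivity
    rw [hc, cHt, ← hA]; linarith
  -- `η ≤ exp(−iL²) ≤ 1`
  have hη1 : |ρ - r| ≤ 1 := hη.trans (by
    rw [Real.exp_le_one_iff]; have : (0 : ℝ) ≤ i * L ^ 2 := by positivity
    linarith)
  -- the root package
  obtain ⟨hS0, hSdeg, y, hy, hpow⟩ := root_package_eps G hK hD hΛ r h0 hη1
  -- size of `p`
  have hr0 : r ≠ 0 := by rintro rfl; simp at hq3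
  have hrq : (r : ℝ) = (r.num : ℝ) / r.den := Rat.cast_def r
  have habsr : |(r : ℝ)| ≤ |ρ| + 1 := by
    have := abs_sub_abs_le_abs_sub (r : ℝ) ρ
    rw [abs_sub_comm] at this; linarith
  have habsp : |(r.num : ℝ)| ≤ (|ρ| + 1) * r.den := by
    have h1 : (r.num : ℝ) = (r : ℝ) * r.den := by rw [hrq]; field_simp
    rw [h1, abs_mul, Nat.abs_cast]
    exact mul_le_mul_of_nonneg_right habsr hq0r.le
  have hpq : |(r.num : ℝ)| + r.den ≤ (|ρ| + 2) * r.den := by nlinarith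
  have hpq0 : (0 : ℝ) < |(r.num : ℝ)| + r.den := by
    have : (0 : ℝ) ≤ |(r.num : ℝ)| := abs_nonneg _
    linarith
  have hlogpq' : Real.log (|(r.num : ℝ)| + r.den) ≤ A * L := by
    have hl2 : 0 ≤ Real.log (|ρ| + 2) := Real.log_nonneg (by linarith [abs_nonneg ρ])
    calc Real.log (|(r.num : ℝ)| + r.den) ≤ Real.log ((|ρ| + 2) * r.den) := Real.log_le_log hpq0 hpq
      _ = Real.log (|ρ| + 2) + L := by
          rw [Real.log_mul (by linarith [abs_nonneg ρ]) hq0r.ne', hL]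
      _ ≤ Real.log (|ρ| + 2) * L + L := by nlinarith
      _ = A * L := by rw [hA, cA]; ring
  -- the budget `q^D (Λ + 1) exp(−iL²) 2^K ≤ exp(−K(m+1)L²)`
  set ε₁ : ℝ := Real.exp (-((m + 1) * L ^ 2)) with hε₁
  have hε₁0 : 0 < ε₁ := Real.exp_pos _
  have hqD : (r.den : ℝ) ^ D ≤ Real.exp ((D : ℝ) * L ^ 2) := by
    calc (r.den : ℝ) ^ D = Real.exp ((D : ℝ) * L) := by rw [Real.exp_nat_mul, hexpL]
      _ ≤ Real.exp ((D : ℝ) * L ^ 2) :=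
          Real.exp_le_exp.mpr (mul_le_mul_of_nonneg_left hLL (Nat.cast_nonneg D))
  have hΛe : Λ + 1 ≤ Real.exp (L ^ 2) := hΛq.trans (by rw [← hexpL]; exact Real.exp_le_exp.mpr hLL)
  have h2Ke : (2 : ℝ) ^ K ≤ Real.exp (L ^ 2) := h2K.trans (by rw [← hexpL]; exact Real.exp_le_exp.mpr hLL)
  have hbudget : (r.den : ℝ) ^ D * ((Λ + 1) * Real.exp (-(i * L ^ 2))) * (2 : ℝ) ^ K ≤
      Real.exp (-((K : ℝ) * ((m + 1) * L ^ 2))) := by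
    calc (r.den : ℝ) ^ D * ((Λ + 1) * Real.exp (-(i * L ^ 2))) * (2 : ℝ) ^ K
        ≤ Real.exp ((D : ℝ) * L ^ 2) * (Real.exp (L ^ 2) * Real.exp (-(i * L ^ 2))) *
            Real.exp (L ^ 2) := by gcongr
      _ = Real.exp (-((K : ℝ) * ((m + 1) * L ^ 2))) := by
          rw [← Real.exp_add, ← Real.exp_add, ← Real.exp_add]; congr 1; rw [hiK]; ring
  have hεK : Real.exp (-((K : ℝ) * ((m + 1) * L ^ 2))) = ε₁ ^ K := by
    rw [hε₁, ← Real.exp_nat_mul]; congr 1; ring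
  -- `‖w − y‖ ≤ ε₁ / 2`
  have hpowle : ‖w - y‖ ^ K ≤ (ε₁ / 2) ^ K := by
    have h1 : (r.den : ℝ) ^ D * (Λ * |ρ - r| + ‖∑ k, aeval (ρ : ℂ) (G k) * w ^ (k : ℕ)‖) ≤
        (r.den : ℝ) ^ D * ((Λ + 1) * Real.exp (-(i * L ^ 2))) := by
      refine mul_le_mul_of_nonneg_left ?_ (by positivity)
      have := mul_le_mul_of_nonneg_left hη hΛ0
      calc Λ * |ρ - r| + ‖∑ k, aeval (ρ : ℂ) (G k) * w ^ (k : ℕ)‖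
          ≤ Λ * Real.exp (-(i * L ^ 2)) + Real.exp (-(i * L ^ 2)) := add_le_add this hε
        _ = (Λ + 1) * Real.exp (-(i * L ^ 2)) := by ring
    have h2 : (r.den : ℝ) ^ D * ((Λ + 1) * Real.exp (-(i * L ^ 2))) ≤ ε₁ ^ K / (2 : ℝ) ^ K := by
      rw [le_div_iff₀ (by positivity), ← hεK]; exact hbudget
    rw [div_pow]; exact hpow.trans (h1.trans h2)
  have hwy : ‖w - y‖ ≤ ε₁ / 2 := le_of_pow_le_pow_left₀ hK.ne' (by positivity) hpowle
  -- `|ρ − r| ≤ ε₁ / 2`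
  have hρr : |ρ - r| ≤ ε₁ / 2 := by
    refine hη.trans ?_
    have h2e : (2 : ℝ) ≤ Real.exp ((i - (m + 1)) * L ^ 2) := by
      have h1 : (1 : ℝ) ≤ (i - (m + 1)) * L ^ 2 := by
        have him : (1 : ℝ) ≤ i - (m + 1) := by
          rw [hiK]
          nlinarith [mul_nonneg (sub_nonneg.mpr hKr) (by linarith : (0 : ℝ) ≤ m + 1)]
        have hL2 : (1 : ℝ) ≤ L ^ 2 := by nlinarith
        exact one_le_mul_of_one_le_of_one_le him hL2
      linarith [Real.add_one_le_exp ((i - (m + 1)) * L ^ 2)]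
    rw [hε₁, le_div_iff₀ (by norm_num : (0 : ℝ) < 2)]
    calc Real.exp (-(i * L ^ 2)) * 2
        ≤ Real.exp (-(i * L ^ 2)) * Real.exp ((i - (m + 1)) * L ^ 2) :=
          mul_le_mul_of_nonneg_left h2e (Real.exp_pos _).le
      _ = Real.exp (-((m + 1) * L ^ 2)) := by rw [← Real.exp_add]; congr 1; ring
  -- `ε₁ ≤ 1/q < ‖w‖`, so `y ≠ 0`
  have hε₁q : ε₁ ≤ 1 / r.den := by
    have h1 : ε₁ ≤ Real.exp (-L) := by
      rw [hε₁, Real.exp_le_exp, neg_le_neg_iff]; nlinarith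
    refine h1.trans_eq ?_
    rw [Real.exp_neg, hexpL, one_div]
  have hy0 : y ≠ 0 := by
    intro hy0; rw [hy0, sub_zero] at hwy; linarith
  -- the linear polynomial of `r`
  obtain ⟨hfdeg, hfroot, hfM⟩ := linear_poly_facts r
  have hfirr := irreducible_den_mul_X_sub_num' r
  set f : ℤ[X] := C (r.den : ℤ) * X + C (-r.num) with hf
  -- `log M(A_q) ≤ c L`
  have hMS : Real.log ((specY G D r.num r.den).map (Int.castRingHom ℂ)).mahlerMeasure ≤ c * L := by
    have hMSle := mahlerMeasure_specY_le G hD r.num r.den hSdeg.le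
    have hMS1 := one_le_mahlerMeasure_int hS0
    have hRL0 : 0 < H := by linarith
    have hK1 : (0 : ℝ) < (K : ℝ) + 1 := by positivity
    calc Real.log ((specY G D r.num r.den).map (Int.castRingHom ℂ)).mahlerMeasure
        ≤ Real.log (((K : ℝ) + 1) * (H * (|(r.num : ℝ)| + r.den) ^ D)) :=
          Real.log_le_log (by linarith) hMSle
      _ = Real.log ((K : ℝ) + 1) + Real.log H + D * Real.log (|(r.num : ℝ)| + r.den) := by
          rw [Real.log_mul hK1.ne' (by positivity), Real.log_mul hRL0.ne' (by positivity),
            Real.log_pow]; ring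
      _ ≤ Real.log ((K : ℝ) + 1) * L + Real.log H * L + D * (A * L) := by
          gcongr ?_ + ?_ + ?_
          · exact le_mul_of_one_le_right hlK0 hL1
          · exact le_mul_of_one_le_right hlR0 hL1
          · exact mul_le_mul_of_nonneg_left hlogpq' (Nat.cast_nonneg D)
      _ ≤ c * L := by
          have h0 : 0 ≤ A * L := by positivity
          have e : c * L = Real.log ((K : ℝ) + 1) * L + Real.log H * L + D * (A * L) +
              A * L + 2 * (A * L) := by rw [hc, cHt, ← hA]; ring
          rw [e]; linarith
  -- `log M(f) ≤ c L`
  have hMf : Real.log ((f.map (Int.castRingHom ℂ)).mahlerMeasure) ≤ c * L := by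
    rw [hfM]
    have h1 : max (|(r.num : ℝ)|) (r.den : ℝ) ≤ |(r.num : ℝ)| + r.den :=
      max_le (by linarith) (by linarith [abs_nonneg (r.num : ℝ)])
    calc Real.log (max (|(r.num : ℝ)|) (r.den : ℝ)) ≤ Real.log (|(r.num : ℝ)| + r.den) :=
          Real.log_le_log (lt_max_of_lt_right hq0r) h1
      _ ≤ A * L := hlogpq'
      _ ≤ c * L := mul_le_mul_of_nonneg_right hAc hL0
  -- the NW lower bound with `N₀ = K` (`deg A_q · deg f = K · 1`)
  have hdegSf : (specY G D r.num r.den).natDegree * f.natDegree ≤ K := by rw [hSdeg, hfdeg, mul_one]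
  have hu0 : ((ρ : ℝ) : ℂ) ≠ 0 := Complex.ofReal_ne_zero.mpr hρ0
  have hβ0 : ((r : ℝ) : ℂ) ≠ 0 := Complex.ofReal_ne_zero.mpr (by exact_mod_cast hr0)
  have hlow := pair_lower_bound hNW hu0 hc0 hq3 hfirr (by rw [hfdeg]; exact one_pos) hS0 hfroot hy
    hy0 hβ0 hdegSf hMS hMf
  have hnorm : ‖((ρ : ℝ) : ℂ)‖ = |ρ| := by rw [Complex.norm_real, Real.norm_eq_abs]
  have hdist : ‖((ρ : ℝ) : ℂ) - ((r : ℝ) : ℂ)‖ = |ρ - r| := by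
    rw [← Complex.ofReal_sub, Complex.norm_real, Real.norm_eq_abs]
  rw [hnorm, hdist] at hlow
  have hκeq : cNW₂ |ρ| * ((K : ℝ) + 1) ^ 5 * (2 + c) ^ 2 = κ := by rw [hκ, cKap]
  rw [hκeq] at hlow
  -- `dist ≤ ε₁ = exp(−(κ+4)L²) < exp(−κL²) ≤ dist`
  have hsum : ‖w - y‖ + |ρ - r| ≤ ε₁ := by linarith
  have hlt : ε₁ < Real.exp (-(κ * L ^ 2)) := by
    rw [hε₁, Real.exp_lt_exp, neg_lt_neg_iff]
    have hL2 : 0 < L ^ 2 := by positivity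
    nlinarith
  linarith

/-- **The constant term case** (`K = 0`): `|G₀(ρ)| ≥ q^{−D} − Λ|ρ − r| ≥ exp(−i (log q)²)` once
`q^D G₀(p/q)` is a non-zero integer, `q ≥ Λ + 1`, `q ≥ 3` and `|ρ − r| ≤ exp(−i (log q)²)`, `i ≥ D + 2`. -/
theorem const_term_lower_bound (G : Fin (K + 1) → ℤ[X]) (hK : K = 0) {D : ℕ}
    (hD : ∀ k, (G k).natDegree ≤ D) {ρ : ℝ} {w : ℂ} {Λ : ℝ} (hΛ0 : 0 ≤ Λ)
    (hΛ : ∀ z : ℂ, ‖z - (ρ : ℂ)‖ ≤ 1 →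
      ‖(sliceAt G w).eval z - (sliceAt G w).eval (ρ : ℂ)‖ ≤ Λ * ‖z - (ρ : ℂ)‖)
    (r : ℚ) (hq3 : 3 ≤ r.den) (h0 : scaleEval (G (Fin.last K)) D r.num r.den ≠ 0)
    (hΛq : Λ + 1 ≤ r.den) {i : ℝ} (hiD : (D : ℝ) + 2 ≤ i)
    (hη : |ρ - r| ≤ Real.exp (-(i * Real.log r.den ^ 2))) :
    Real.exp (-(i * Real.log r.den ^ 2)) ≤ ‖∑ k : Fin (K + 1), aeval (ρ : ℂ) (G k) * w ^ (k : ℕ)‖ := by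
  subst hK
  have hq3r : (3 : ℝ) ≤ r.den := by exact_mod_cast hq3
  have hq0r : (0 : ℝ) < r.den := by linarith
  set L : ℝ := Real.log r.den with hL
  have hL1 : 1 ≤ L := one_le_log_of_three_le hq3r
  have hexpL : Real.exp L = r.den := by rw [hL, Real.exp_log hq0r]
  set t : ℝ := (r.den : ℝ) ^ D with ht
  have ht0 : 0 < t := by positivity
  -- the value at `r`: `|Σ_k G_k(r) w^k| = |scaleEval| / q^D ≥ 1/t`
  have hval : 1 / t ≤ ‖(sliceAt G w).eval ((r : ℝ) : ℂ)‖ := by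
    have e := aeval_specY G hD r.num r.den_nz w
    have hspec : aeval w (specY G D r.num r.den) = (scaleEval (G (Fin.last 0)) D r.num r.den : ℂ) := by
      unfold specY
      simp
    have hpq : ((r.num : ℤ) : ℂ) / ((r.den : ℕ) : ℂ) = ((r : ℝ) : ℂ) := (ratCast_eq_num_div_den r).symm
    rw [hspec, hpq, ← eval_sliceAt] at e
    -- `e : (scaleEval : ℂ) = q^D * S(r)`
    have hn : (1 : ℝ) ≤ ‖((scaleEval (G (Fin.last 0)) D r.num r.den : ℤ) : ℂ)‖ := by
      rw [Complex.norm_intCast]; exact_mod_cast Int.one_le_abs h0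
    rw [e, norm_mul, Complex.norm_pow, Complex.norm_natCast, ← ht] at hn
    rw [div_le_iff₀ ht0]; linarith
  -- `η ≤ exp(−iL²) ≤ q^{−(D+2)} = 1/(t q²)`
  have hηsmall : Real.exp (-(i * L ^ 2)) ≤ 1 / (t * (r.den : ℝ) ^ 2) := by
    have h1 : Real.exp (-(i * L ^ 2)) ≤ Real.exp (-(((D : ℝ) + 2) * L)) := by
      rw [Real.exp_le_exp, neg_le_neg_iff]
      have hi0 : 0 ≤ i := by linarith [(Nat.cast_nonneg D : (0 : ℝ) ≤ D)]
      have h1 : ((D : ℝ) + 2) * L ≤ i * L := mul_le_mul_of_nonneg_right hiD (by linarith)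
      have h2 : i * L ≤ i * L ^ 2 := mul_le_mul_of_nonneg_left (by nlinarith) hi0
      linarith
    refine h1.trans_eq ?_
    rw [Real.exp_neg, ht, ← pow_add, ← hexpL, ← Real.exp_nat_mul, one_div]
    push_cast; ring_nf
  -- `|S(ρ)| ≥ |S(r)| − Λ η ≥ 1/t − Λ/(t q²) ≥ 1/t − 1/(t q)`
  have hdist : ‖(((r : ℝ) : ℂ)) - (ρ : ℂ)‖ = |ρ - r| := by
    rw [← Complex.ofReal_sub, Complex.norm_real, Real.norm_eq_abs, abs_sub_comm]
  have hη1 : |ρ - r| ≤ 1 := hη.trans (by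
    rw [Real.exp_le_one_iff]
    have : (0 : ℝ) ≤ i * L ^ 2 := by
      have : (0 : ℝ) ≤ i := by linarith [(Nat.cast_nonneg D : (0 : ℝ) ≤ D)]
      positivity
    linarith)
  have hLip := hΛ ((r : ℝ) : ℂ) (by rw [hdist]; exact hη1)
  rw [hdist] at hLip
  have hρval : (sliceAt G w).eval (ρ : ℂ) = ∑ k, aeval (ρ : ℂ) (G k) * w ^ (k : ℕ) := eval_sliceAt G w ρ
  have htri : ‖(sliceAt G w).eval ((r : ℝ) : ℂ)‖ - Λ * |ρ - r| ≤ ‖(sliceAt G w).eval (ρ : ℂ)‖ := by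
    have h1 : ‖(sliceAt G w).eval ((r : ℝ) : ℂ)‖ ≤
        ‖(sliceAt G w).eval ((r : ℝ) : ℂ) - (sliceAt G w).eval (ρ : ℂ)‖ + ‖(sliceAt G w).eval (ρ : ℂ)‖ := by
      calc ‖(sliceAt G w).eval ((r : ℝ) : ℂ)‖
          = ‖((sliceAt G w).eval ((r : ℝ) : ℂ) - (sliceAt G w).eval (ρ : ℂ)) +
              (sliceAt G w).eval (ρ : ℂ)‖ := by rw [sub_add_cancel]
        _ ≤ _ := norm_add_le _ _
    linarith
  have hΛη : Λ * |ρ - r| ≤ 1 / (t * r.den) := by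
    have h1 : Λ * |ρ - r| ≤ Λ * (1 / (t * (r.den : ℝ) ^ 2)) :=
      mul_le_mul_of_nonneg_left (hη.trans hηsmall) hΛ0
    have hΛle : Λ ≤ r.den := by linarith
    have h2 : Λ * (1 / (t * (r.den : ℝ) ^ 2)) ≤ 1 / (t * r.den) := by
      calc Λ * (1 / (t * (r.den : ℝ) ^ 2)) ≤ (r.den : ℝ) * (1 / (t * (r.den : ℝ) ^ 2)) :=
            mul_le_mul_of_nonneg_right hΛle (by positivity)
        _ = 1 / (t * r.den) := by
            rw [mul_one_div, div_eq_div_iff (by positivity) (by positivity)]; ring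
    exact h1.trans h2
  -- conclude: `exp(−iL²) ≤ 1/(t q²) ≤ 1/t − 1/(tq) ≤ |S(ρ)|`
  rw [← hρval]
  have hfin : 1 / (t * (r.den : ℝ) ^ 2) ≤ 1 / t - 1 / (t * r.den) := by
    have hq1 : 1 / (r.den : ℝ) ≤ 1 / 3 := one_div_le_one_div_of_le (by norm_num) hq3r
    have hq2 : 1 / (r.den : ℝ) ^ 2 ≤ 1 / 9 := by
      rw [show (9 : ℝ) = 3 ^ 2 by norm_num]
      exact one_div_le_one_div_of_le (by norm_num) (pow_le_pow_left₀ (by norm_num) hq3r 2)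
    have hT0 : 0 < 1 / t := by positivity
    rw [← one_div_mul_one_div t ((r.den : ℝ) ^ 2), ← one_div_mul_one_div t (r.den : ℝ)]
    linarith [mul_le_mul_of_nonneg_left hq1 hT0.le, mul_le_mul_of_nonneg_left hq2 hT0.le]
  linarith [hval, htri, hΛη, hfin, hηsmall]

end Summit.Schanuel.Schanuel.Theorems.RootDecomp1ETwoScale
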